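import Summits.QuantumFields.BalabanUV.T4Continuum.Support.NE7TensionEnergyTowerGap
import Summits.QuantumFields.BalabanUV.T4Continuum.Support.NE3CombVsTowerEnd
import Summits.QuantumFields.BalabanUV.T4Continuum.Support.NE3CovariantLineSumsL2TowerSharp
import HarnessLib

/-!
# NE7TowerGapFromC1 — THE TOWER GAP (TG) DISCHARGED FROM THE NE3 C1 TOWER: the ℓ² distance on torus 1-forms between the exact straight
# part `M^d•Ad_{cavgIter}∘QbarIter L (j+2) U` and the κ-last comb line sum `TWg M (combFrame U M)` is `δ‖b‖` with an EXPLICIT `δ`; the energy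
# road's end holds under an explicit class-smallness inequality instead of the hypothesis (TG)

Cell `pub-balaban`, rung (B)+1 sub-cell t4, lineage `b2b-balaban-t4-ne7-p1`, generation 63 (CRUX PROVER NE7 #1, ruling e34b3e0c (2)); hunt (h7)
«ENERGY ROAD», the step after `NE7TensionEnergyTowerGap`, whose only analytic hypothesis was (TG):
`‖resF N (z κ ↦ M^d • Ad_{cavgIter L (j+2) U z κ}(QbarIter L (j+2) U (extF b) z κ)) − resF N (TWg M (combFrame U M) (extF b))‖ ≤ δ‖b‖`, `8δ ≤ √λ′`.
HERE (TG) is PROVED from two tree towers with `δ = √(card n)·(C₁·√(M^d)·M + M^d·2K·radSum d L (j+1) x·ρ^{j+1})`, `C₁ = 2·((4d+5)∕10·DSum d L (j+2) x)`,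
`K = 160064·d(d+1)(d+4)·L³`, `ρ = rho d L = √(L²∕L^d)`, `x` the small-field radius, under the sharp tower's smallness `K·radSum ≤ ρ∕2`, `L ≥ 2`:
§1 norm conversions (`‖resF N A‖² ≤ l2sq A`, `l2sq (extF b) ≤ card n·‖b‖²`: normalised Hilbert–Schmidt vs operator norm [Balaban1985Averaging, (20)]);
§2 **`sum_norm_TWg_sub_smul_Ad_QstrIter_sq_le`** — the straight term = `NE3CombVsTowerEnd.sum_norm_TWc_sub_Ad_QstrIter_sq_le` (C1 tower END)
   rescaled by `M^d` (`TWc L (j+2) U = TWg M (combFrame U M)` by definition);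
§3 **`sum_norm_smul_Ad_ErrIter_sq_le`** — the error term = `NE3CovariantLineSumsL2TowerSharp.sqrt_l2sq_ErrIter_le_sharp`, `Ad` of the unitary
   `cavgIter` an isometry; §4 **`towerGap_le`** — (TG) with the explicit `δ`, for EVERY torus 1-form `b`, via `QbarIter = QstrIter + ErrIter`;
§5 **`eight_mul_delta_le_sqrt`** — `8·√(3·card n)·(C₁ + 2K·radSum·√(L^d∕L²)) ≤ 1 ⟹ 8δ ≤ √λ′` (`M^d·ρ^{j+1} = √(M^d)·M·√(L^d∕L²)`, `M^d·M²∕3 ≤ λ′`);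
§6 **`tension_energy_le_of_C1_tower`** — `tension_energy_le_of_towerGap` with (TG) DISCHARGED: the tension energy of an interior `(j+2)`-level
   constrained minimiser is `≤ 13·N^d·d·(4d·M^d·a·(1+(d+1)(M−1)Ma))²∕λ′ + (7(Λ′+δ)²∕λ′ + 4)·θ₀²` under `L ≥ 2`, two smallness inequalities on the
   class radius (explicit: `DSum`, `radSum` are the tree's polynomials in the radii) and INTERIORITY (8) (`a < ε(L^{j+2})^{−2}`, B11 Theorem 1
   type — the hypothesis it is in `critical_of_interior_isMinimiser`).
HONEST FRAMING (page 1): assembly at ONE interior constrained minimiser on a FIXED FINITE torus, rung (B)+1, CONDITIONAL on (8) and on explicit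
smallness of the class radius; NE7, NE3 NOT PRINTED in [Balaban1984PropagatorsI]–[Balaban1989LargeFieldII] and NOT PROVED; continuum YM on T⁴ ⇐
BetaPertH ∧ nine spine estimates (0/9 proved); BetaPertH ⇐ (D1) ∧ (D4) ∧ CAP+tail; G-an2-4 gates asym, D1 and NE2/3/4; NOT infinite volume, NOT
mass gap, NOT Clay.  0 def, 0 sorry.
-/

set_option autoImplicit false

open scoped BigOperators InnerProductSpace Matrix Matrix.Norms.L2Operator
open Finset

namespace Summit.QuantumFields.BalabanUV.T4Continuum.NE7TowerGapFromC1

open Literature.MathematicalPhysics.QuantumFieldTheory.Balaban1983to89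
open B7Prop1Explicit B7Prop2Explicit MatrixNorms UnitaryModel
open T4AveragingDeficitWall (IsUnitaryCfg IsSkewDir SmallField Ad flux)
open T4AveragingDeficitWallBoundary (periodBox IsPeriodicCfg)
open AveragingDeficitPeriodicCounting (IsPeriodicDir)
open AveragingDeficitTransport (norm_Ad_of_unitary)
open AveragingDeficitNearIdentity (Ad_add)
open AveragingDeficitMultiLevelPrep (cavgIter tower LevelSmall cavgIter_unitary_small)
open ReplicationRightInverseBound (radSum radSum_nonneg)
open MinimalActionSandwich (IsMinimiser)
open MinimalActionRate (sfClass)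
open NE3TangentCovariantTower (QbarIter)
open NE3CovariantCalculus (cDstar)
open NE3CovariantLineAdjoint
open NE3HilbertSchmidtTorus
open NE3CovariantLineSumsTower (QstrIter ErrIter QbarIter_eq_QstrIter_add_ErrIter)
open NE3CovariantLineSumsL2 (l2sq l2sq_nonneg)
open NE3CovariantLineSumsL2Tower (rho rho_nonneg)
open NE3CovariantLineSumsL2TowerSharp (sqrt_l2sq_ErrIter_le_sharp)
open NE3ExactLineSumsTower (DSum DSum_nonneg)
open NE3CombVsTowerEnd (sum_norm_TWc_sub_Ad_QstrIter_sq_le)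
open NE3SmoothLiftW (tower_eq_pow_mul)
open NE7TensionEnergyTowerGap (tension_energy_le_of_towerGap)

noncomputable section

variable {d : ℕ} {n : Type*} [Fintype n] [DecidableEq n]

/-! ## §1 Normalised Hilbert–Schmidt norms against operator norms on the torus -/

/-- `‖resF N A‖² ≤ l2sq (periodBox N) A`: the torus-form norm (normalised Hilbert–Schmidt per bond) is below the `ℓ²` sum of the operator
norms. [cite: Balaban1985Averaging, (20) p.21] -/
theorem norm_resF_sq_le_l2sq (N : ℕ) (A : Site d → Fin d → Matrix n n ℂ) :
    ‖resF (d := d) N A‖ ^ 2 ≤ l2sq (periodBox (d := d) N) A := by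
  rw [norm_sq_resF]
  exact Finset.sum_le_sum fun z _ => Finset.sum_le_sum fun κ _ => nhsNormSq_le_opNorm_sq _

/-- `l2sq (periodBox P) (extF P b) ≤ card n · ‖b‖²`: the `ℓ²` sum of the operator norms of a torus 1-form is at most `card n` times its
norm. [cite: Balaban1985Averaging, (20) p.21] -/
theorem l2sq_extF_le (P : ℕ) [NeZero P] (b : Form d n P) :
    l2sq (periodBox (d := d) P) (extF P b) ≤ Fintype.card n * ‖b‖ ^ 2 := by
  rw [norm_sq_eq_sum_extF, Finset.mul_sum]
  refine Finset.sum_le_sum fun x _ => ?_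
  rw [Finset.mul_sum]
  exact Finset.sum_le_sum fun κ _ => opNorm_sq_le_card_mul_nhsNormSq _

/-! ## §2 The straight term: the C1 tower END rescaled by `M^d` -/

/-- **STRAIGHT TERM.**  For unitary `W`, `x ≥ 0`, `LevelSmall d L (j+1) x`, `SmallField W x`, `L ≥ 2`, `N ≥ 1` and an `(L^{j+2}N)`-periodic `Y`,
with `M = L^{j+2}` and `C₁ = 2·((4d+5)∕10·DSum d L (j+2) x)`:
`Σ_{z∈periodBox N} Σ_κ ‖TWg M (combFrame W M) Y z κ − M^d • Ad_{cavgIter L (j+2) W z κ}(QstrIter L (j+2) W Y z κ)‖² ≤ C₁²·(M^d·M²)·l2sq_{fine} Y`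
— `NE3CombVsTowerEnd.sum_norm_TWc_sub_Ad_QstrIter_sq_le` multiplied through by `M^{2d}`. [folklore] -/
theorem sum_norm_TWg_sub_smul_Ad_QstrIter_sq_le [Nonempty n] {L N : ℕ} (hL2 : 2 ≤ L) (hN : 1 ≤ N) (j : ℕ)
    {W : Site d → Fin d → (Matrix n n ℂ)ˣ} {x : ℝ} (hWu : IsUnitaryCfg W) (hx : 0 ≤ x) (hls : LevelSmall d L (j + 1) x)
    (hWx : SmallField W x) {Y : Site d → Fin d → Matrix n n ℂ} (hY : IsPeriodicDir Y ((L ^ (j + 2) * N : ℕ) : ℤ)) :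
    ∑ z ∈ periodBox (d := d) N, ∑ κ : Fin d,
        ‖TWg (L ^ (j + 2)) (combFrame W (L ^ (j + 2))) Y z κ
            - (((L ^ (j + 2) : ℕ) : ℝ) ^ d) • Ad (cavgIter L (j + 2) W z κ) (QstrIter L (j + 2) W Y z κ)‖ ^ 2
      ≤ (2 * ((4 * d + 5) / 10 * DSum d L (j + 2) x)) ^ 2 * ((((L ^ (j + 2) : ℕ) : ℝ) ^ d) * ((L ^ (j + 2) : ℕ) : ℝ) ^ 2)
          * l2sq (periodBox (d := d) (L ^ (j + 2) * N)) Y := by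
  have h := sum_norm_TWc_sub_Ad_QstrIter_sq_le hL2 hN (j + 1) hWu hx hls hWx Y hY
  simp only [show j + 1 + 1 = j + 2 from rfl] at h
  rw [show (∑ y ∈ periodBox (d := d) (L ^ (j + 2) * N), ∑ κ : Fin d, ‖Y y κ‖ ^ 2)
      = l2sq (periodBox (d := d) (L ^ (j + 2) * N)) Y from rfl] at h
  have hL0 : (0 : ℝ) < L := by exact_mod_cast (lt_of_lt_of_le (by norm_num) hL2)
  have hMR : ((L ^ (j + 2) : ℕ) : ℝ) = (L : ℝ) ^ (j + 2) := by push_cast; rfl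
  have hMd0 : 0 ≤ ((L ^ (j + 2) : ℕ) : ℝ) ^ d := by positivity
  -- `M^d · ρ = 1`
  have hρ : ((L ^ (j + 2) : ℕ) : ℝ) ^ d * (((L : ℝ) ^ d)⁻¹) ^ (j + 2) = 1 := by
    rw [hMR, ← pow_mul, inv_pow, ← pow_mul, mul_comm (j + 2) d]
    exact mul_inv_cancel₀ (pow_ne_zero _ hL0.ne')
  -- pointwise rescaling
  have hpt : ∀ (z : Site d) (κ : Fin d),
      ‖TWg (L ^ (j + 2)) (combFrame W (L ^ (j + 2))) Y z κ
          - (((L ^ (j + 2) : ℕ) : ℝ) ^ d) • Ad (cavgIter L (j + 2) W z κ) (QstrIter L (j + 2) W Y z κ)‖ ^ 2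
        = (((L ^ (j + 2) : ℕ) : ℝ) ^ d) ^ 2
            * ‖(((L : ℝ) ^ d)⁻¹) ^ (j + 2) • TWc L (j + 2) W Y z κ
                - Ad (cavgIter L (j + 2) W z κ) (QstrIter L (j + 2) W Y z κ)‖ ^ 2 := by
    intro z κ
    have e : TWg (L ^ (j + 2)) (combFrame W (L ^ (j + 2))) Y z κ
          - (((L ^ (j + 2) : ℕ) : ℝ) ^ d) • Ad (cavgIter L (j + 2) W z κ) (QstrIter L (j + 2) W Y z κ)
        = (((L ^ (j + 2) : ℕ) : ℝ) ^ d) • ((((L : ℝ) ^ d)⁻¹) ^ (j + 2) • TWc L (j + 2) W Y z κ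
            - Ad (cavgIter L (j + 2) W z κ) (QstrIter L (j + 2) W Y z κ)) := by
      rw [smul_sub, smul_smul, hρ, one_smul]; rfl
    rw [e, norm_smul, Real.norm_of_nonneg hMd0, mul_pow]
  simp_rw [hpt, ← Finset.mul_sum]
  refine (mul_le_mul_of_nonneg_left h (sq_nonneg _)).trans_eq ?_
  rw [← hMR]
  linear_combination ((2 * ((4 * d + 5) / 10 * DSum d L (j + 2) x)) ^ 2 * ((L ^ (j + 2) : ℕ) : ℝ) ^ 2
    * l2sq (periodBox (d := d) (L ^ (j + 2) * N)) Y * ((L ^ (j + 2) : ℕ) : ℝ) ^ d) * hρ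

/-! ## §3 The error term: the sharp `ErrIter` tower rescaled by `M^d` -/

/-- **ERROR TERM.**  Under the sharp tower's smallness `K·radSum d L (j+1) x ≤ ρ∕2` (`K = 160064·d(d+1)(d+4)L³`, `ρ = rho d L`), for unitary
`(L^{j+2}N)`-periodic `W` with `LevelSmall d L (j+1) x`, `SmallField W x` and an `(L^{j+2}N)`-periodic `Y`:
`Σ_{z∈periodBox N} Σ_κ ‖M^d • Ad_{cavgIter L (j+2) W z κ}(ErrIter L (j+2) W Y z κ)‖² ≤ (M^d·2K·radSum·ρ^{j+1})²·l2sq_{fine} Y`. [folklore] -/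
theorem sum_norm_smul_Ad_ErrIter_sq_le [Nonempty n] {L N : ℕ} (hL : 1 ≤ L) (hN : 1 ≤ N) (j : ℕ)
    {W : Site d → Fin d → (Matrix n n ℂ)ˣ} {x : ℝ} (hWu : IsUnitaryCfg W) (hWP : IsPeriodicCfg W ((L ^ (j + 2) * N : ℕ) : ℤ))
    (hx : 0 ≤ x) (hls : LevelSmall d L (j + 1) x) (hWx : SmallField W x)
    (hKS : (160064 * (d : ℝ) * (d + 1) * (d + 4) * (L : ℝ) ^ 3) * radSum d L (j + 1) x ≤ rho d L / 2)
    {Y : Site d → Fin d → Matrix n n ℂ} (hY : IsPeriodicDir Y ((L ^ (j + 2) * N : ℕ) : ℤ)) :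
    ∑ z ∈ periodBox (d := d) N, ∑ κ : Fin d,
        ‖(((L ^ (j + 2) : ℕ) : ℝ) ^ d) • Ad (cavgIter L (j + 2) W z κ) (ErrIter L (j + 2) W Y z κ)‖ ^ 2
      ≤ (((L ^ (j + 2) : ℕ) : ℝ) ^ d
            * (2 * ((160064 * (d : ℝ) * (d + 1) * (d + 4) * (L : ℝ) ^ 3) * radSum d L (j + 1) x) * rho d L ^ (j + 1))) ^ 2
          * l2sq (periodBox (d := d) (L ^ (j + 2) * N)) Y := by
  obtain ⟨hcU, -, -⟩ := cavgIter_unitary_small hL (j + 1) hWu hx hls hWx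
  have hWP' : IsPeriodicCfg W ((tower L N (j + 1 + 1) : ℕ) : ℤ) := by rw [tower_eq_pow_mul]; exact hWP
  have hY' : IsPeriodicDir Y ((tower L N (j + 1 + 1) : ℕ) : ℤ) := by rw [tower_eq_pow_mul]; exact hY
  have hE := sqrt_l2sq_ErrIter_le_sharp hL hN (j + 1) hWu hWP' hx hls hWx hKS hY'
  simp only [show j + 1 + 1 = j + 2 from rfl, tower_eq_pow_mul] at hE
  have hMd0 : 0 ≤ ((L ^ (j + 2) : ℕ) : ℝ) ^ d := by positivity
  have hK0 : 0 ≤ 2 * ((160064 * (d : ℝ) * (d + 1) * (d + 4) * (L : ℝ) ^ 3) * radSum d L (j + 1) x) * rho d L ^ (j + 1) := by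
    have := radSum_nonneg (d := d) (L := L) (j + 1) hx
    have := rho_nonneg d L
    positivity
  -- square the sharp tower bound
  have hE2 : l2sq (periodBox (d := d) N) (ErrIter L (j + 2) W Y)
      ≤ (2 * ((160064 * (d : ℝ) * (d + 1) * (d + 4) * (L : ℝ) ^ 3) * radSum d L (j + 1) x) * rho d L ^ (j + 1)) ^ 2
          * l2sq (periodBox (d := d) (L ^ (j + 2) * N)) Y := by
    calc l2sq (periodBox (d := d) N) (ErrIter L (j + 2) W Y)
          = Real.sqrt (l2sq (periodBox (d := d) N) (ErrIter L (j + 2) W Y)) ^ 2 := (Real.sq_sqrt (l2sq_nonneg _ _)).symm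
      _ ≤ (2 * ((160064 * (d : ℝ) * (d + 1) * (d + 4) * (L : ℝ) ^ 3) * radSum d L (j + 1) x) * rho d L ^ (j + 1)
              * Real.sqrt (l2sq (periodBox (d := d) (L ^ (j + 2) * N)) Y)) ^ 2 :=
            pow_le_pow_left₀ (Real.sqrt_nonneg _) hE 2
      _ = _ := by rw [mul_pow, Real.sq_sqrt (l2sq_nonneg _ _)]
  have hAd : ∀ (z : Site d) (κ : Fin d) (X : Matrix n n ℂ), ‖Ad (cavgIter L (j + 2) W z κ) X‖ = ‖X‖ :=
    fun z κ X => norm_Ad_of_unitary (hcU z κ) X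
  simp_rw [norm_smul, hAd, Real.norm_of_nonneg hMd0, mul_pow, ← Finset.mul_sum]
  exact (mul_le_mul_of_nonneg_left hE2 (sq_nonneg _)).trans_eq (by ring)

/-! ## §4 The tower gap (TG) with an explicit constant -/

/-- **THE TOWER GAP (TG), PROVED.**  For unitary `(L^{j+2}N)`-periodic `W`, `x ≥ 0`, `LevelSmall d L (j+1) x`, `SmallField W x`, `L ≥ 2`,
`N ≥ 1`, the sharp smallness `K·radSum d L (j+1) x ≤ ρ∕2`, and EVERY torus 1-form `b` of period `M·N` (`M = L^{j+2}`):
`‖resF N (z κ ↦ M^d • Ad_{cavgIter L (j+2) W z κ}(QbarIter L (j+2) W (extF b) z κ)) − resF N (TWg M (combFrame W M) (extF b))‖ ≤ δ‖b‖`,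
`δ = √(card n)·(C₁·(√(M^d)·M) + M^d·(2K·radSum·ρ^{j+1}))`. [folklore] -/
theorem towerGap_le [Nonempty n] {L N : ℕ} (hL2 : 2 ≤ L) (hN : 1 ≤ N) (j : ℕ)
    {W : Site d → Fin d → (Matrix n n ℂ)ˣ} {x : ℝ} (hWu : IsUnitaryCfg W) (hWP : IsPeriodicCfg W ((L ^ (j + 2) * N : ℕ) : ℤ))
    (hx : 0 ≤ x) (hls : LevelSmall d L (j + 1) x) (hWx : SmallField W x)
    (hKS : (160064 * (d : ℝ) * (d + 1) * (d + 4) * (L : ℝ) ^ 3) * radSum d L (j + 1) x ≤ rho d L / 2)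
    [NeZero N] [NeZero (L ^ (j + 2) * N)] (b : Form d n (L ^ (j + 2) * N)) :
    ‖resF (d := d) N (fun z κ => (((L ^ (j + 2) : ℕ) : ℝ) ^ d) •
          Ad (cavgIter L (j + 2) W z κ) (QbarIter L (j + 2) W (extF (L ^ (j + 2) * N) b) z κ))
        - resF (d := d) N (TWg (L ^ (j + 2)) (combFrame W (L ^ (j + 2))) (extF (L ^ (j + 2) * N) b))‖
      ≤ (Real.sqrt (Fintype.card n)
          * ((2 * ((4 * d + 5) / 10 * DSum d L (j + 2) x)) * (Real.sqrt (((L ^ (j + 2) : ℕ) : ℝ) ^ d) * ((L ^ (j + 2) : ℕ) : ℝ))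
            + ((L ^ (j + 2) : ℕ) : ℝ) ^ d
              * (2 * ((160064 * (d : ℝ) * (d + 1) * (d + 4) * (L : ℝ) ^ 3) * radSum d L (j + 1) x) * rho d L ^ (j + 1))))
        * ‖b‖ := by
  have hL : 1 ≤ L := le_trans (by norm_num) hL2
  set Y : Site d → Fin d → Matrix n n ℂ := extF (L ^ (j + 2) * N) b with hYdef
  have hY : IsPeriodicDir Y ((L ^ (j + 2) * N : ℕ) : ℤ) := isPeriodicDir_extF _ b
  have hQE := QbarIter_eq_QstrIter_add_ErrIter hL (j + 1) hWu hx hls hWx Y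
  simp only [show j + 1 + 1 = j + 2 from rfl] at hQE
  -- abbreviations for the constants
  have hMd0 : 0 ≤ ((L ^ (j + 2) : ℕ) : ℝ) ^ d := by positivity
  have hC0 : 0 ≤ 2 * ((4 * d + 5) / 10 * DSum d L (j + 2) x) := by
    have := DSum_nonneg d L (j + 2) hx; positivity
  have hK0 : 0 ≤ 2 * ((160064 * (d : ℝ) * (d + 1) * (d + 4) * (L : ℝ) ^ 3) * radSum d L (j + 1) x) * rho d L ^ (j + 1) := by
    have := radSum_nonneg (d := d) (L := L) (j + 1) hx
    have := rho_nonneg d L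
    positivity
  have hcard0 : (0 : ℝ) ≤ Fintype.card n := Nat.cast_nonneg _
  have hfine : l2sq (periodBox (d := d) (L ^ (j + 2) * N)) Y ≤ Fintype.card n * ‖b‖ ^ 2 := l2sq_extF_le _ b
  -- the two pieces
  set A : Site d → Fin d → Matrix n n ℂ := fun z κ =>
    TWg (L ^ (j + 2)) (combFrame W (L ^ (j + 2))) Y z κ
      - (((L ^ (j + 2) : ℕ) : ℝ) ^ d) • Ad (cavgIter L (j + 2) W z κ) (QstrIter L (j + 2) W Y z κ) with hA
  set B : Site d → Fin d → Matrix n n ℂ := fun z κ =>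
    (((L ^ (j + 2) : ℕ) : ℝ) ^ d) • Ad (cavgIter L (j + 2) W z κ) (ErrIter L (j + 2) W Y z κ) with hB
  -- the difference is `resF B − resF A`
  have hsplit : resF (d := d) N (fun z κ => (((L ^ (j + 2) : ℕ) : ℝ) ^ d) •
          Ad (cavgIter L (j + 2) W z κ) (QbarIter L (j + 2) W Y z κ))
        - resF (d := d) N (TWg (L ^ (j + 2)) (combFrame W (L ^ (j + 2))) Y)
      = resF (d := d) N B - resF (d := d) N A := by
    rw [← resF_sub, ← resF_sub]
    congr 1
    funext z κ
    simp only [hA, hB, hQE, Ad_add, smul_add]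
    abel
  -- norms of the pieces
  have hnA : ‖resF (d := d) N A‖
      ≤ Real.sqrt (Fintype.card n) * ((2 * ((4 * d + 5) / 10 * DSum d L (j + 2) x))
          * (Real.sqrt (((L ^ (j + 2) : ℕ) : ℝ) ^ d) * ((L ^ (j + 2) : ℕ) : ℝ))) * ‖b‖ := by
    refine le_of_pow_le_pow_left₀ two_ne_zero (by positivity) ?_
    have h1 := sum_norm_TWg_sub_smul_Ad_QstrIter_sq_le hL2 hN j hWu hx hls hWx hY
    calc ‖resF (d := d) N A‖ ^ 2 ≤ l2sq (periodBox (d := d) N) A := norm_resF_sq_le_l2sq N A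
      _ ≤ (2 * ((4 * d + 5) / 10 * DSum d L (j + 2) x)) ^ 2 * ((((L ^ (j + 2) : ℕ) : ℝ) ^ d) * ((L ^ (j + 2) : ℕ) : ℝ) ^ 2)
            * l2sq (periodBox (d := d) (L ^ (j + 2) * N)) Y := h1
      _ ≤ (2 * ((4 * d + 5) / 10 * DSum d L (j + 2) x)) ^ 2 * ((((L ^ (j + 2) : ℕ) : ℝ) ^ d) * ((L ^ (j + 2) : ℕ) : ℝ) ^ 2)
            * (Fintype.card n * ‖b‖ ^ 2) := mul_le_mul_of_nonneg_left hfine (by positivity)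
      _ = _ := by simp only [mul_pow, Real.sq_sqrt hcard0, Real.sq_sqrt hMd0]; ring
  have hnB : ‖resF (d := d) N B‖
      ≤ Real.sqrt (Fintype.card n) * (((L ^ (j + 2) : ℕ) : ℝ) ^ d
          * (2 * ((160064 * (d : ℝ) * (d + 1) * (d + 4) * (L : ℝ) ^ 3) * radSum d L (j + 1) x) * rho d L ^ (j + 1))) * ‖b‖ := by
    refine le_of_pow_le_pow_left₀ two_ne_zero (by positivity) ?_
    have h1 := sum_norm_smul_Ad_ErrIter_sq_le hL hN j hWu hWP hx hls hWx hKS hY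
    calc ‖resF (d := d) N B‖ ^ 2 ≤ l2sq (periodBox (d := d) N) B := norm_resF_sq_le_l2sq N B
      _ ≤ (((L ^ (j + 2) : ℕ) : ℝ) ^ d
            * (2 * ((160064 * (d : ℝ) * (d + 1) * (d + 4) * (L : ℝ) ^ 3) * radSum d L (j + 1) x) * rho d L ^ (j + 1))) ^ 2
            * l2sq (periodBox (d := d) (L ^ (j + 2) * N)) Y := h1
      _ ≤ (((L ^ (j + 2) : ℕ) : ℝ) ^ d
            * (2 * ((160064 * (d : ℝ) * (d + 1) * (d + 4) * (L : ℝ) ^ 3) * radSum d L (j + 1) x) * rho d L ^ (j + 1))) ^ 2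
            * (Fintype.card n * ‖b‖ ^ 2) := mul_le_mul_of_nonneg_left hfine (sq_nonneg _)
      _ = _ := by simp only [mul_pow, Real.sq_sqrt hcard0]; ring
  rw [hsplit]
  calc ‖resF (d := d) N B - resF (d := d) N A‖ ≤ ‖resF (d := d) N B‖ + ‖resF (d := d) N A‖ := norm_sub_le _ _
    _ ≤ _ := by nlinarith [hnA, hnB, norm_nonneg b]

/-! ## §5 Arithmetic: a closed-form sufficient condition for `8δ ≤ √λ′` -/

/-- `M^d·ρ^{j+1} = √(M^d)·M·√(L^d∕L²)` for `M = L^{j+2}`, `ρ = √(L²∕L^d)`, `L ≥ 1`. [folklore] -/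
theorem pow_mul_rho_pow_eq {L : ℕ} (hL : 1 ≤ L) (d j : ℕ) :
    ((L ^ (j + 2) : ℕ) : ℝ) ^ d * rho d L ^ (j + 1)
      = Real.sqrt (((L ^ (j + 2) : ℕ) : ℝ) ^ d) * ((L ^ (j + 2) : ℕ) : ℝ) * Real.sqrt ((L : ℝ) ^ d / (L : ℝ) ^ 2) := by
  have hL0 : (0 : ℝ) < L := by exact_mod_cast hL
  have hMR : ((L ^ (j + 2) : ℕ) : ℝ) = (L : ℝ) ^ (j + 2) := by push_cast; rfl
  have hq0 : 0 ≤ (L : ℝ) ^ 2 / (L : ℝ) ^ d := by positivity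
  have hq0' : 0 ≤ (L : ℝ) ^ d / (L : ℝ) ^ 2 := by positivity
  have hMd0 : 0 ≤ ((L ^ (j + 2) : ℕ) : ℝ) ^ d := by positivity
  have hl : 0 ≤ ((L ^ (j + 2) : ℕ) : ℝ) ^ d * rho d L ^ (j + 1) := mul_nonneg hMd0 (pow_nonneg (rho_nonneg d L) _)
  have hr : 0 ≤ Real.sqrt (((L ^ (j + 2) : ℕ) : ℝ) ^ d) * ((L ^ (j + 2) : ℕ) : ℝ) * Real.sqrt ((L : ℝ) ^ d / (L : ℝ) ^ 2) := by
    positivity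
  have hr2 : (rho d L ^ (j + 1)) ^ 2 = ((L : ℝ) ^ 2 / (L : ℝ) ^ d) ^ (j + 1) := by
    rw [← pow_mul, mul_comm, pow_mul, rho, Real.sq_sqrt hq0]
  rw [← Real.sqrt_sq hl, ← Real.sqrt_sq hr]
  congr 1
  simp only [mul_pow, Real.sq_sqrt hMd0, Real.sq_sqrt hq0']
  rw [hr2, hMR, div_pow, ← mul_div_assoc, ← mul_div_assoc, div_eq_div_iff (by positivity) (by positivity)]
  ring

/-- `M^d·M²∕3 ≤ λ′ = M^{d−1}·(M(M²+2)∕3)` for `M ≥ 1` (also at `d = 0`, where `M^{d−1} = 1`). [folklore] -/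
theorem gram_floor_ge {M : ℝ} (hM : 1 ≤ M) (d : ℕ) : M ^ d * M ^ 2 / 3 ≤ M ^ (d - 1) * (M * (M ^ 2 + 2) / 3) := by
  have hM0 : 0 ≤ M := le_trans zero_le_one hM
  have hpow : M ^ d ≤ M ^ (d - 1) * M := by
    rcases Nat.eq_zero_or_pos d with hd | hd
    · subst hd; simpa using hM
    · rw [← pow_succ, Nat.sub_add_cancel hd]
  have h1 : 0 ≤ M ^ (d - 1) := pow_nonneg hM0 _
  nlinarith [mul_le_mul_of_nonneg_right hpow (sq_nonneg M), h1, sq_nonneg M, mul_nonneg h1 hM0]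

/-- **CLOSED-FORM SUFFICIENT CONDITION.**  With `c = card n`, `C₁, E ≥ 0`: if `8·√(3c)·(C₁ + E·√(L^d∕L²)) ≤ 1` then
`8·√c·(C₁·(√(M^d)·M) + M^d·(E·ρ^{j+1})) ≤ √(M^{d−1}·(M(M²+2)∕3))` (`M = L^{j+2} ≥ 1`). [folklore] -/
theorem eight_mul_delta_le_sqrt {L : ℕ} (hL : 1 ≤ L) (d j : ℕ) {c C E : ℝ} (hC : 0 ≤ C) (hE : 0 ≤ E)
    (h : 8 * Real.sqrt (3 * c) * (C + E * Real.sqrt ((L : ℝ) ^ d / (L : ℝ) ^ 2)) ≤ 1) :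
    8 * (Real.sqrt c * (C * (Real.sqrt (((L ^ (j + 2) : ℕ) : ℝ) ^ d) * ((L ^ (j + 2) : ℕ) : ℝ))
          + ((L ^ (j + 2) : ℕ) : ℝ) ^ d * (E * rho d L ^ (j + 1))))
      ≤ Real.sqrt (((L ^ (j + 2) : ℕ) : ℝ) ^ (d - 1)
          * (((L ^ (j + 2) : ℕ) : ℝ) * (((L ^ (j + 2) : ℕ) : ℝ) ^ 2 + 2) / 3)) := by
  have hM1 : (1 : ℝ) ≤ ((L ^ (j + 2) : ℕ) : ℝ) := by exact_mod_cast Nat.one_le_pow _ _ hL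
  have hM0 : 0 ≤ ((L ^ (j + 2) : ℕ) : ℝ) := le_trans zero_le_one hM1
  have hMd0 : 0 ≤ ((L ^ (j + 2) : ℕ) : ℝ) ^ d := by positivity
  have hq0' : 0 ≤ Real.sqrt ((L : ℝ) ^ d / (L : ℝ) ^ 2) := Real.sqrt_nonneg _
  -- rewrite the error monomial
  have hre : ((L ^ (j + 2) : ℕ) : ℝ) ^ d * (E * rho d L ^ (j + 1))
      = E * (Real.sqrt (((L ^ (j + 2) : ℕ) : ℝ) ^ d) * ((L ^ (j + 2) : ℕ) : ℝ) * Real.sqrt ((L : ℝ) ^ d / (L : ℝ) ^ 2)) := by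
    rw [← pow_mul_rho_pow_eq hL d j]; ring
  rw [hre]
  -- `S := √(M^d)·M`
  set S : ℝ := Real.sqrt (((L ^ (j + 2) : ℕ) : ℝ) ^ d) * ((L ^ (j + 2) : ℕ) : ℝ) with hS
  have hS0 : 0 ≤ S := by positivity
  have hX0 : 0 ≤ C + E * Real.sqrt ((L : ℝ) ^ d / (L : ℝ) ^ 2) := by positivity
  -- the left side is `S · (8·√c·X)`
  have hlhs : 8 * (Real.sqrt c * (C * S + E * (S * Real.sqrt ((L : ℝ) ^ d / (L : ℝ) ^ 2))))
      = S * (8 * Real.sqrt c * (C + E * Real.sqrt ((L : ℝ) ^ d / (L : ℝ) ^ 2))) := by ring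
  have hS' : Real.sqrt (((L ^ (j + 2) : ℕ) : ℝ) ^ d) * ((L ^ (j + 2) : ℕ) : ℝ) * Real.sqrt ((L : ℝ) ^ d / (L : ℝ) ^ 2)
      = S * Real.sqrt ((L : ℝ) ^ d / (L : ℝ) ^ 2) := by rw [hS]
  rw [hS', hlhs]
  -- `8·√c·X ≤ 1∕√3`
  have h3 : (0 : ℝ) < Real.sqrt 3 := Real.sqrt_pos.mpr (by norm_num)
  have hsmall : 8 * Real.sqrt c * (C + E * Real.sqrt ((L : ℝ) ^ d / (L : ℝ) ^ 2)) ≤ 1 / Real.sqrt 3 := by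
    rw [le_div_iff₀ h3]
    calc 8 * Real.sqrt c * (C + E * Real.sqrt ((L : ℝ) ^ d / (L : ℝ) ^ 2)) * Real.sqrt 3
        = 8 * Real.sqrt (3 * c) * (C + E * Real.sqrt ((L : ℝ) ^ d / (L : ℝ) ^ 2)) := by
          rw [Real.sqrt_mul (by norm_num : (0:ℝ) ≤ 3)]; ring
      _ ≤ 1 := h
  -- compare `S∕√3` with `√λ′`
  have hS2 : S ^ 2 = ((L ^ (j + 2) : ℕ) : ℝ) ^ d * ((L ^ (j + 2) : ℕ) : ℝ) ^ 2 := by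
    rw [hS, mul_pow, Real.sq_sqrt hMd0]
  calc S * (8 * Real.sqrt c * (C + E * Real.sqrt ((L : ℝ) ^ d / (L : ℝ) ^ 2)))
      ≤ S * (1 / Real.sqrt 3) := mul_le_mul_of_nonneg_left hsmall hS0
    _ = Real.sqrt (S ^ 2 / 3) := by
          rw [Real.sqrt_div' _ (by norm_num : (0:ℝ) ≤ 3), Real.sqrt_sq hS0]; ring
    _ ≤ _ := by
          refine Real.sqrt_le_sqrt ?_
          rw [hS2]
          exact gram_floor_ge hM1 d

/-! ## §6 The energy road's end with (TG) discharged -/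

/-- **THE ENERGY ROAD'S END, (TG) DISCHARGED.**  `U` an interior `(j+2)`-level constrained minimiser of `sfClass d L N ε` (`L ≥ 2`, `N ≥ 1`,
`SmallField U a`, `0 ≤ a ≤ 1∕4`, `a < x := ε∕(L^{j+2})²`, `LevelSmall d L (j+1) x`), `B` its flux form, `M = L^{j+2}`, and the two EXPLICIT smallness
inequalities of the class radius along the tower: `K·radSum d L (j+1) x ≤ ρ∕2` and `8·√(3·card n)·(C₁ + 2K·radSum d L (j+1) x·√(L^d∕L²)) ≤ 1`
(`K = 160064·d(d+1)(d+4)L³`, `C₁ = 2·((4d+5)∕10·DSum d L (j+2) x)`, `ρ = √(L²∕L^d)`).  THEN, with `δ` of `towerGap_le`, the tension energy obeys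
`Σ_{x∈periodBox (M·N)} Σ_ν nhsNormSq (T_ν(x)) ≤ 13·N^d·d·(2d·M^d·(2a)·(1+(d+1)(M−1)Ma))²∕λ′ + (7(Λ′+δ)²∕λ′ + 4)·θ₀²` — NO tower hypothesis left;
INTERIORITY (8) remains. [folklore] -/
theorem tension_energy_le_of_C1_tower [Nonempty n] {L N : ℕ} (hL2 : 2 ≤ L) (hN : 1 ≤ N) {ε a : ℝ} (j : ℕ)
    {V U : Site d → Fin d → (Matrix n n ℂ)ˣ} (hmin : IsMinimiser d (sfClass d L N ε) L N (j + 2) V U)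
    (ha0 : 0 ≤ a) (ha4 : a ≤ 1 / 4) (haε : a < ε / ((L : ℝ) ^ (j + 2)) ^ 2) (hUa : SmallField U a)
    (hls : LevelSmall d L (j + 1) (ε / ((L : ℝ) ^ (j + 2)) ^ 2))
    (hKS : (160064 * (d : ℝ) * (d + 1) * (d + 4) * (L : ℝ) ^ 3) * radSum d L (j + 1) (ε / ((L : ℝ) ^ (j + 2)) ^ 2) ≤ rho d L / 2)
    (hsmall : 8 * Real.sqrt (3 * Fintype.card n)
        * (2 * ((4 * d + 5) / 10 * DSum d L (j + 2) (ε / ((L : ℝ) ^ (j + 2)) ^ 2))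
            + 2 * ((160064 * (d : ℝ) * (d + 1) * (d + 4) * (L : ℝ) ^ 3) * radSum d L (j + 1) (ε / ((L : ℝ) ^ (j + 2)) ^ 2))
              * Real.sqrt ((L : ℝ) ^ d / (L : ℝ) ^ 2)) ≤ 1)
    {B : Site d → Fin d → Fin d → Matrix n n ℂ} (hBF : ∀ (x : Site d) (μ ν : Fin d) (h : μ < ν), B x μ ν = flux U (x, ⟨(μ, ν), h⟩))
    (hanti : ∀ (x : Site d) (μ ν : Fin d), B x ν μ = -B x μ ν)
    [NeZero N] [NeZero (L ^ (j + 2) * N)] :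
    ∑ x ∈ periodBox (d := d) (L ^ (j + 2) * N), ∑ ν : Fin d, nhsNormSq (∑ μ : Fin d, cDstar U μ (fun y => B y μ ν) x)
      ≤ 13 * ((N : ℝ) ^ d * d * (2 * d * ((L ^ (j + 2) : ℕ) : ℝ) ^ d * (2 * a)
                * (1 + ((d : ℝ) + 1) * (((L ^ (j + 2) : ℕ) : ℝ) - 1) * ((L ^ (j + 2) : ℕ) : ℝ) * a)) ^ 2)
            / (((L ^ (j + 2) : ℕ) : ℝ) ^ (d - 1) * (((L ^ (j + 2) : ℕ) : ℝ) * (((L ^ (j + 2) : ℕ) : ℝ) ^ 2 + 2) / 3))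
        + (7 * (Real.sqrt (((L ^ (j + 2) : ℕ) : ℝ) ^ (d - 1) * ((L ^ (j + 2) : ℕ) : ℝ) ^ 3)
              + Real.sqrt (Fintype.card n)
                * ((2 * ((4 * d + 5) / 10 * DSum d L (j + 2) (ε / ((L : ℝ) ^ (j + 2)) ^ 2)))
                    * (Real.sqrt (((L ^ (j + 2) : ℕ) : ℝ) ^ d) * ((L ^ (j + 2) : ℕ) : ℝ))
                  + ((L ^ (j + 2) : ℕ) : ℝ) ^ d
                    * (2 * ((160064 * (d : ℝ) * (d + 1) * (d + 4) * (L : ℝ) ^ 3)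
                        * radSum d L (j + 1) (ε / ((L : ℝ) ^ (j + 2)) ^ 2)) * rho d L ^ (j + 1)))) ^ 2
              / (((L ^ (j + 2) : ℕ) : ℝ) ^ (d - 1) * (((L ^ (j + 2) : ℕ) : ℝ) * (((L ^ (j + 2) : ℕ) : ℝ) ^ 2 + 2) / 3)) + 4)
          * (12 * (Fintype.card (T4AveragingDeficitWall.Plane d) : ℝ) * a ^ 2
              * Real.sqrt (d * (((L ^ (j + 2) * N : ℕ) : ℕ) : ℝ) ^ d * Fintype.card n)) ^ 2 := by
  have hL : 1 ≤ L := le_trans (by norm_num) hL2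
  have hU : IsUnitaryCfg U := hmin.mem.1.1
  have hUP : IsPeriodicCfg U ((L ^ (j + 2) * N : ℕ) : ℤ) := by rw [Nat.mul_comm]; exact hmin.mem.1.2.1
  have hx : 0 ≤ ε / ((L : ℝ) ^ (j + 2)) ^ 2 := ha0.trans haε.le
  have hUx : SmallField U (ε / ((L : ℝ) ^ (j + 2)) ^ 2) := fun y κ κ' hne => (hUa y κ κ' hne).trans haε.le
  have hC0 : 0 ≤ 2 * ((4 * d + 5) / 10 * DSum d L (j + 2) (ε / ((L : ℝ) ^ (j + 2)) ^ 2)) := by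
    have := DSum_nonneg d L (j + 2) hx; positivity
  have hE0 : 0 ≤ 2 * ((160064 * (d : ℝ) * (d + 1) * (d + 4) * (L : ℝ) ^ 3) * radSum d L (j + 1) (ε / ((L : ℝ) ^ (j + 2)) ^ 2)) := by
    have := radSum_nonneg (d := d) (L := L) (j + 1) hx; positivity
  have hδ0 : 0 ≤ Real.sqrt (Fintype.card n)
      * ((2 * ((4 * d + 5) / 10 * DSum d L (j + 2) (ε / ((L : ℝ) ^ (j + 2)) ^ 2)))
          * (Real.sqrt (((L ^ (j + 2) : ℕ) : ℝ) ^ d) * ((L ^ (j + 2) : ℕ) : ℝ))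
        + ((L ^ (j + 2) : ℕ) : ℝ) ^ d
          * (2 * ((160064 * (d : ℝ) * (d + 1) * (d + 4) * (L : ℝ) ^ 3)
              * radSum d L (j + 1) (ε / ((L : ℝ) ^ (j + 2)) ^ 2)) * rho d L ^ (j + 1))) := by
    have := rho_nonneg d L; positivity
  have hδ := eight_mul_delta_le_sqrt hL d j hC0 hE0 hsmall
  exact tension_energy_le_of_towerGap hL hN j hmin ha0 ha4 haε hUa hls hBF hanti hδ0 hδ
    (fun b _ => towerGap_le hL2 hN j hU hUP hx hls hUx hKS b)

end

end Summit.QuantumFields.BalabanUV.T4Continuum.NE7TowerGapFromC1
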